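import Summits.QuantumFields.YangMills.Theorems.UnitScaleTiltProp7CovLineGradFrame
import HarnessLib

/-!
# Route `UnitScaleTilt`, crux K1 «MinimiserStabilityRegPr» (stmt-QuantumFields-19200), route-R [RP] at a curved background — THE CURVED N6,
# ROW (R-B), PART 6d (last piece of FILE 3): THE ONE-STEP COVARIANT GRADIENT TRANSFER IN `ℓ²` —
# `‖∇^{Ū}LINE_VZ‖_{ℓ²} ≤ L^{(4−d)/2}·‖∇^VZ‖_{ℓ²} + √d·[2L²δ·L^{(4−d)/2} + (2(d+2)²L²δ + 4θ)·L^{(2−d)/2}]·‖Z‖_{ℓ²}`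

Cell `ym3-torus`, D-0154 (3c) R3 twin-width seat `ym-routeR-w2` (W-SEAT MAP pass #3 row M9; architecture «ℓ²-Minkowski over levels, level-local», ★★OWNER g26
ACK 12).  THEOREMS ONLY (0 `def`, 0 `sorry`); `--supports stmt-QuantumFields-19200`, count-neutral.  YM₃ on T³ is a ladder rung (R3), not the Clay problem; nothing here
claims the curved N6 bound, S2, P, the crux or the gap.

THE STEP.  Square-sum the pointwise inequality of `Prop7CovLineGradFrame.norm_covGrad_line_le` over the coarse bonds `(y, μ)` and directions `ν`; Minkowski separates the
three pieces; the main piece is counted with constant EXACTLY `L⁴·L^{−d}` (Jensen over the `L^{d+2}` terms, then «(block, offset) ↔ site» and translation bijections —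
`Prop7TrueLinLineBound.sum_site_eq_sum_blockSite`, `sum_shift_iterate`), the mass pieces likewise.  At `d = 3` the gradient energy of the pure `LINE`-iterate grows by at
most `√L` per level up to curvature defects — the geometric law of `Prop7IterLambdaBound`, now at a curved background.
* §1 counting letters (`sq_sum3_le`, `sq_sum2_le`, `sum_sq_blockDoubleLine_le`, `sum_sq_blockLine_le`, `sum_comp_shift_coarse`).
* §2 ★★ `sqrt_sum_normSq_covGrad_line_le` — the displayed `ℓ²` inequality.
HONEST SCOPE.  One level; the iteration along the tower and the junction `G_j` vs the pure `LINE`-iterate (✓ p608741) are the next file.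

References: T. Bałaban, CMP 95 (1984) 17–40 [Balaban1984PropagatorsI] ((1.18)–(1.20) pp.19–20); CMP 99 (1985) 75–102 [Balaban1985RegularSpaces] ((1.1) p.76).
-/

noncomputable section

open scoped BigOperators Matrix.Norms.L2Operator

namespace Summit.QuantumFields.YangMills.Theorems.Prop7CovLineGradL2

open Literature.MathematicalPhysics.QuantumFieldTheory.Balaban1983to89
open Finset T4Continuum BlockAveraging AveragingRT ExpMeanLog BlockAveragingEMLLinearised BlockAveragingEMLLinearisedBackground BlockAveragingEMLProp2
open B10StarCount (sum_pbond shiftEquiv)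
open Summit.QuantumFields.YangMills.Theorems.Prop7TrueLinLineBound (sum_site_eq_sum_blockSite sum_shift_iterate)
open Summit.QuantumFields.YangMills.Theorems.Prop7CovIterLambdaBound (sqrt_sum_sq_add_le)
open Summit.QuantumFields.YangMills.Theorems.Prop7CovLineGradFrame (norm_covGrad_line_le)

variable {P : Params} {n : Type*} [Fintype n] [DecidableEq n] [Nonempty n] {j : ℕ}

/-! ## §1 Counting letters -/

omit [Fintype n] [DecidableEq n] [Nonempty n] in
/-- Jensen over the `L^d·L·L` terms of a block∕double-line sum: `(L^{−d}Σ_{r,s,t} a)² ≤ L²·L^{−d}·Σ_{r,s,t} a²`. [folklore] -/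
theorem sq_sum3_le (a : (Fin P.d → Fin P.L) → ℕ → ℕ → ℝ) :
    ((((P.L : ℝ)) ^ P.d)⁻¹ * ∑ r : Fin P.d → Fin P.L, ∑ s ∈ range P.L, ∑ t ∈ range P.L, a r s t) ^ 2
      ≤ (P.L : ℝ) ^ 2 * (((P.L : ℝ)) ^ P.d)⁻¹ * ∑ r : Fin P.d → Fin P.L, ∑ s ∈ range P.L, ∑ t ∈ range P.L, a r s t ^ 2 := by
  have hLd : (0 : ℝ) < (P.L : ℝ) ^ P.d := by have := P.L_pos; positivity
  set S : Finset ((Fin P.d → Fin P.L) × ℕ × ℕ) := univ ×ˢ (range P.L ×ˢ range P.L) with hS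
  have hflat : ∀ f : (Fin P.d → Fin P.L) → ℕ → ℕ → ℝ,
      ∑ r : Fin P.d → Fin P.L, ∑ s ∈ range P.L, ∑ t ∈ range P.L, f r s t = ∑ p ∈ S, f p.1 p.2.1 p.2.2 := by
    intro f
    rw [hS, Finset.sum_product]
    exact Finset.sum_congr rfl fun r _ => by rw [Finset.sum_product]
  have hcard : (S.card : ℝ) = (P.L : ℝ) ^ P.d * ((P.L : ℝ) * P.L) := by
    rw [hS, Finset.card_product, Finset.card_product, Finset.card_univ, Fintype.card_fun, Fintype.card_fin, Fintype.card_fin, Finset.card_range]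
    push_cast; ring
  rw [hflat a, hflat (fun r s t => a r s t ^ 2)]
  have h := sq_sum_le_card_mul_sum_sq (s := S) (f := fun p => a p.1 p.2.1 p.2.2)
  rw [hcard] at h
  rw [mul_pow]
  calc (((P.L : ℝ) ^ P.d)⁻¹) ^ 2 * (∑ p ∈ S, a p.1 p.2.1 p.2.2) ^ 2
      ≤ (((P.L : ℝ) ^ P.d)⁻¹) ^ 2 * ((P.L : ℝ) ^ P.d * ((P.L : ℝ) * P.L) * ∑ p ∈ S, a p.1 p.2.1 p.2.2 ^ 2) :=
        mul_le_mul_of_nonneg_left h (sq_nonneg _)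
    _ = (P.L : ℝ) ^ 2 * ((P.L : ℝ) ^ P.d)⁻¹ * ∑ p ∈ S, a p.1 p.2.1 p.2.2 ^ 2 := by field_simp

omit [Fintype n] [DecidableEq n] [Nonempty n] in
/-- Jensen over the `L^d·L` terms of a block∕line sum: `(L^{−d}Σ_{r,t} a)² ≤ L·L^{−d}·Σ_{r,t} a²`. [folklore] -/
theorem sq_sum2_le (a : (Fin P.d → Fin P.L) → ℕ → ℝ) :
    ((((P.L : ℝ)) ^ P.d)⁻¹ * ∑ r : Fin P.d → Fin P.L, ∑ t ∈ range P.L, a r t) ^ 2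
      ≤ (P.L : ℝ) * (((P.L : ℝ)) ^ P.d)⁻¹ * ∑ r : Fin P.d → Fin P.L, ∑ t ∈ range P.L, a r t ^ 2 := by
  have hLd : (0 : ℝ) < (P.L : ℝ) ^ P.d := by have := P.L_pos; positivity
  set S : Finset ((Fin P.d → Fin P.L) × ℕ) := univ ×ˢ range P.L with hS
  have hflat : ∀ f : (Fin P.d → Fin P.L) → ℕ → ℝ, ∑ r : Fin P.d → Fin P.L, ∑ t ∈ range P.L, f r t = ∑ p ∈ S, f p.1 p.2 := by
    intro f; rw [hS, Finset.sum_product]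
  have hcard : (S.card : ℝ) = (P.L : ℝ) ^ P.d * (P.L : ℝ) := by
    rw [hS, Finset.card_product, Finset.card_univ, Fintype.card_fun, Fintype.card_fin, Fintype.card_fin, Finset.card_range]; push_cast; ring
  rw [hflat a, hflat (fun r t => a r t ^ 2)]
  have h := sq_sum_le_card_mul_sum_sq (s := S) (f := fun p => a p.1 p.2)
  rw [hcard] at h
  rw [mul_pow]
  calc (((P.L : ℝ) ^ P.d)⁻¹) ^ 2 * (∑ p ∈ S, a p.1 p.2) ^ 2
      ≤ (((P.L : ℝ) ^ P.d)⁻¹) ^ 2 * ((P.L : ℝ) ^ P.d * (P.L : ℝ) * ∑ p ∈ S, a p.1 p.2 ^ 2) := mul_le_mul_of_nonneg_left h (sq_nonneg _)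
    _ = (P.L : ℝ) * ((P.L : ℝ) ^ P.d)⁻¹ * ∑ p ∈ S, a p.1 p.2 ^ 2 := by field_simp

omit [Fintype n] [DecidableEq n] [Nonempty n] in
/-- **THE DOUBLE-LINE COUNTING** (constant exactly `L⁴·L^{−d}`): `Σ_y (L^{−d}Σ_rΣ_{s<L}Σ_{t<L} g(x_r(y) + se_ν + te_μ))² ≤ L²·L²·L^{−d}·Σ_x g(x)²`.
[cite: Balaban1984PropagatorsI, (1.18)-(1.20) pp.19-20] -/
theorem sum_sq_blockDoubleLine_le (hj : j + 1 ≤ P.m + P.K) (g : Site P j → ℝ) (μ ν : Fin P.d) :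
    ∑ y : Site P (j + 1), ((((P.L : ℝ)) ^ P.d)⁻¹ * ∑ r : Fin P.d → Fin P.L, ∑ s ∈ range P.L, ∑ t ∈ range P.L,
        g ((fun z : Site P j => z.shift μ)^[t] ((fun z : Site P j => z.shift ν)^[s] (Site.blockSite y r)))) ^ 2
      ≤ (P.L : ℝ) ^ 2 * (P.L : ℝ) ^ 2 * (((P.L : ℝ)) ^ P.d)⁻¹ * ∑ x : Site P j, g x ^ 2 := by
  refine (Finset.sum_le_sum fun y _ => sq_sum3_le (P := P)
    (fun r s t => g ((fun z : Site P j => z.shift μ)^[t] ((fun z : Site P j => z.shift ν)^[s] (Site.blockSite y r))))).trans ?_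
  rw [← Finset.mul_sum]
  have hex : ∑ y : Site P (j + 1), ∑ r : Fin P.d → Fin P.L, ∑ s ∈ range P.L, ∑ t ∈ range P.L,
        g ((fun z : Site P j => z.shift μ)^[t] ((fun z : Site P j => z.shift ν)^[s] (Site.blockSite y r))) ^ 2
      = ∑ s ∈ range P.L, ∑ t ∈ range P.L, ∑ x : Site P j, g x ^ 2 := by
    calc _ = ∑ y : Site P (j + 1), ∑ r : Fin P.d → Fin P.L, ∑ p ∈ range P.L ×ˢ range P.L,
          g ((fun z : Site P j => z.shift μ)^[p.2] ((fun z : Site P j => z.shift ν)^[p.1] (Site.blockSite y r))) ^ 2 :=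
            Finset.sum_congr rfl fun y _ => Finset.sum_congr rfl fun r _ => by rw [Finset.sum_product]
      _ = ∑ y : Site P (j + 1), ∑ p ∈ range P.L ×ˢ range P.L, ∑ r : Fin P.d → Fin P.L,
          g ((fun z : Site P j => z.shift μ)^[p.2] ((fun z : Site P j => z.shift ν)^[p.1] (Site.blockSite y r))) ^ 2 :=
            Finset.sum_congr rfl fun y _ => Finset.sum_comm
      _ = ∑ p ∈ range P.L ×ˢ range P.L, ∑ y : Site P (j + 1), ∑ r : Fin P.d → Fin P.L,
          g ((fun z : Site P j => z.shift μ)^[p.2] ((fun z : Site P j => z.shift ν)^[p.1] (Site.blockSite y r))) ^ 2 := Finset.sum_comm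
      _ = ∑ p ∈ range P.L ×ˢ range P.L, ∑ x : Site P j, g ((fun z : Site P j => z.shift μ)^[p.2] ((fun z : Site P j => z.shift ν)^[p.1] x)) ^ 2 :=
            Finset.sum_congr rfl fun p _ => (sum_site_eq_sum_blockSite hj (fun x =>
              g ((fun z : Site P j => z.shift μ)^[p.2] ((fun z : Site P j => z.shift ν)^[p.1] x)) ^ 2)).symm
      _ = ∑ p ∈ range P.L ×ˢ range P.L, ∑ x : Site P j, g x ^ 2 := by
            refine Finset.sum_congr rfl fun p _ => ?_
            rw [sum_shift_iterate ν (fun x => g ((fun z : Site P j => z.shift μ)^[p.2] x) ^ 2) p.1,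
              sum_shift_iterate μ (fun x => g x ^ 2) p.2]
      _ = _ := by rw [Finset.sum_product]
  rw [hex, Finset.sum_const, Finset.card_range, Finset.sum_const, Finset.card_range, nsmul_eq_mul, nsmul_eq_mul]
  ring_nf
  exact le_rfl

omit [Fintype n] [DecidableEq n] [Nonempty n] in
/-- Translation invariance of coarse-torus sums. [folklore] -/
theorem sum_comp_shift_coarse {M : Type*} [AddCommMonoid M] (F : Site P (j + 1) → M) (ν : Fin P.d) :
    ∑ y : Site P (j + 1), F (y.shift ν) = ∑ y : Site P (j + 1), F y :=
  Equiv.sum_comp (shiftEquiv (P := P) (i := j + 1) ν) F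

omit [Fintype n] [DecidableEq n] [Nonempty n] in
/-- **THE LINE COUNTING** (constant exactly `L·L^{−d}·L`): `Σ_y (L^{−d}Σ_rΣ_{t<L} h(x_r(y+e_ν) + te_μ))² ≤ L·L^{−d}·L·Σ_x h(x)²`. [cite: Balaban1984PropagatorsI, (1.11) p.19] -/
theorem sum_sq_blockLine_le (hj : j + 1 ≤ P.m + P.K) (h : Site P j → ℝ) (μ ν : Fin P.d) :
    ∑ y : Site P (j + 1), ((((P.L : ℝ)) ^ P.d)⁻¹ * ∑ r : Fin P.d → Fin P.L, ∑ t ∈ range P.L,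
        h ((fun z : Site P j => z.shift μ)^[t] (Site.blockSite (y.shift ν) r))) ^ 2
      ≤ (P.L : ℝ) * (((P.L : ℝ)) ^ P.d)⁻¹ * (P.L : ℝ) * ∑ x : Site P j, h x ^ 2 := by
  rw [sum_comp_shift_coarse (fun y : Site P (j + 1) => ((((P.L : ℝ)) ^ P.d)⁻¹ * ∑ r : Fin P.d → Fin P.L, ∑ t ∈ range P.L,
        h ((fun z : Site P j => z.shift μ)^[t] (Site.blockSite y r))) ^ 2) ν]
  refine (Finset.sum_le_sum fun y _ => sq_sum2_le (P := P) (fun r t => h ((fun z : Site P j => z.shift μ)^[t] (Site.blockSite y r)))).trans ?_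
  rw [← Finset.mul_sum]
  have hex : ∑ y : Site P (j + 1), ∑ r : Fin P.d → Fin P.L, ∑ t ∈ range P.L, h ((fun z : Site P j => z.shift μ)^[t] (Site.blockSite y r)) ^ 2
      = (P.L : ℝ) * ∑ x : Site P j, h x ^ 2 := by
    calc _ = ∑ x : Site P j, ∑ t ∈ range P.L, h ((fun z : Site P j => z.shift μ)^[t] x) ^ 2 :=
          (sum_site_eq_sum_blockSite hj (fun x => ∑ t ∈ range P.L, h ((fun z : Site P j => z.shift μ)^[t] x) ^ 2)).symm
      _ = ∑ t ∈ range P.L, ∑ x : Site P j, h ((fun z : Site P j => z.shift μ)^[t] x) ^ 2 := Finset.sum_comm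
      _ = ∑ _t ∈ range P.L, ∑ x : Site P j, h x ^ 2 := Finset.sum_congr rfl fun t _ => sum_shift_iterate μ (fun x => h x ^ 2) t
      _ = (P.L : ℝ) * ∑ x : Site P j, h x ^ 2 := by rw [Finset.sum_const, Finset.card_range, nsmul_eq_mul]
  rw [hex]
  ring_nf
  exact le_rfl

/-! ## §2 ★★ The one-step covariant gradient transfer in `ℓ²` -/

/-- Minkowski on a double-indexed family (bonds × directions), three summands. [folklore] -/
theorem sqrt_sum_sum_sq_add3_le {k : ℕ} (a b c : PBond P k → Fin P.d → ℝ) (ha : ∀ p ν, 0 ≤ a p ν) (hb : ∀ p ν, 0 ≤ b p ν) (hc : ∀ p ν, 0 ≤ c p ν) :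
    Real.sqrt (∑ p : PBond P k, ∑ ν : Fin P.d, (a p ν + b p ν + c p ν) ^ 2)
      ≤ Real.sqrt (∑ p : PBond P k, ∑ ν : Fin P.d, a p ν ^ 2) + Real.sqrt (∑ p : PBond P k, ∑ ν : Fin P.d, b p ν ^ 2)
        + Real.sqrt (∑ p : PBond P k, ∑ ν : Fin P.d, c p ν ^ 2) := by
  have hflat : ∀ f : PBond P k → Fin P.d → ℝ, ∑ p : PBond P k, ∑ ν : Fin P.d, f p ν = ∑ q : PBond P k × Fin P.d, f q.1 q.2 :=
    fun f => (Fintype.sum_prod_type fun q : PBond P k × Fin P.d => f q.1 q.2).symm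
  rw [hflat, hflat, hflat, hflat]
  have h1 := sqrt_sum_sq_add_le (Finset.univ : Finset (PBond P k × Fin P.d)) (fun q => a q.1 q.2 + b q.1 q.2) (fun q => c q.1 q.2)
    (fun q _ => add_nonneg (ha _ _) (hb _ _)) (fun q _ => hc _ _)
  have h2 := sqrt_sum_sq_add_le (Finset.univ : Finset (PBond P k × Fin P.d)) (fun q => a q.1 q.2) (fun q => b q.1 q.2)
    (fun q _ => ha _ _) (fun q _ => hb _ _)
  linarith

set_option maxHeartbeats 400000 in
/-- ★★ **THE ONE-STEP COVARIANT GRADIENT TRANSFER IN `ℓ²`**: for an `SU(N)` background `V` of `T^{(j)}` with `PlaqSmall δ V` and (0.4) loop variables within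
`θ < δ_N`, `θ ≤ 1/6`, of `1` at every coarse bond, and every bond field `Z`,
`√(Σ_{c,ν} ‖Ū(c₋,ν)·LINE_VZ(c+e_ν)·Ū(c₋,ν)* − LINE_VZ(c)‖²) ≤ √(L⁴L^{−d})·√(Σ_{b,ν}‖(∇^V_νZ)(b)‖²) + [2L²δ·√(L⁴L^{−d}·d) + (2(d+2)²L²δ + 4θ)·√(L²L^{−d}·d)]·√(Σ_b‖Z(b)‖²)`
(`Ū = avgFun ℰ V`).  At `d = 3`: `√L` per level on the gradient energy, `O(L^{3/2}δ + θL^{−1/2})` on the mass. [cite: Balaban1984PropagatorsI, (1.18)-(1.20) pp.19-20] -/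
theorem sqrt_sum_normSq_covGrad_line_le (hj : j + 1 ≤ P.m + P.K) (V : GaugeField P j (Matrix.specialUnitaryGroup n ℂ)) {δ : ℝ} (hδ : 0 ≤ δ)
    (hV : PlaqSmall δ V) (Z : PBond P j → Matrix n n ℂ) {θ : ℝ} (hθ : ∀ (c : PBond P (j + 1)) (i : Idx P), dist1 (loopHol V c i) ≤ θ)
    (hθN : θ < deltaSU n) (hθ6 : θ ≤ 1 / 6) :
    Real.sqrt (∑ c : PBond P (j + 1), ∑ ν : Fin P.d,
        ‖((avgFun (expMeanLogSU (n := n)) V ⟨c.src, ν⟩ : Matrix.specialUnitaryGroup n ℂ) : Matrix n n ℂ)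
            * (((Fintype.card (Idx P) : ℂ))⁻¹ • ∑ i : Idx P,
                ((holAt V (walk (emb (c.src.shift ν)) (stairWord i.2.1 (off i.1))) : Matrix.specialUnitaryGroup n ℂ) : Matrix n n ℂ) *
                  covWalkSum V Z (walk (walkEnd (emb (c.src.shift ν)) (stairWord i.2.1 (off i.1))) (List.replicate P.L (c.dir, true))) *
                star ((holAt V (walk (emb (c.src.shift ν)) (stairWord i.2.1 (off i.1))) : Matrix.specialUnitaryGroup n ℂ) : Matrix n n ℂ))
            * star ((avgFun (expMeanLogSU (n := n)) V ⟨c.src, ν⟩ : Matrix.specialUnitaryGroup n ℂ) : Matrix n n ℂ)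
          - ((Fintype.card (Idx P) : ℂ))⁻¹ • ∑ i : Idx P,
              ((holAt V (walk (emb c.src) (stairWord i.2.1 (off i.1))) : Matrix.specialUnitaryGroup n ℂ) : Matrix n n ℂ) *
                covWalkSum V Z (walk (walkEnd (emb c.src) (stairWord i.2.1 (off i.1))) (List.replicate P.L (c.dir, true))) *
              star ((holAt V (walk (emb c.src) (stairWord i.2.1 (off i.1))) : Matrix.specialUnitaryGroup n ℂ) : Matrix n n ℂ)‖ ^ 2)
      ≤ Real.sqrt ((P.L : ℝ) ^ 2 * (P.L : ℝ) ^ 2 * ((P.L : ℝ) ^ P.d)⁻¹)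
          * Real.sqrt (∑ b : PBond P j, ∑ ν : Fin P.d,
              ‖((V ⟨b.src, ν⟩ : Matrix.specialUnitaryGroup n ℂ) : Matrix n n ℂ) * Z ⟨b.src.shift ν, b.dir⟩
                  * star ((V ⟨b.src, ν⟩ : Matrix.specialUnitaryGroup n ℂ) : Matrix n n ℂ) - Z b‖ ^ 2)
        + (2 * (P.L : ℝ) ^ 2 * δ * Real.sqrt ((P.L : ℝ) ^ 2 * (P.L : ℝ) ^ 2 * ((P.L : ℝ) ^ P.d)⁻¹ * P.d)
            + (2 * ((P.d : ℝ) + 2) ^ 2 * (P.L : ℝ) ^ 2 * δ + 4 * θ) * Real.sqrt ((P.L : ℝ) * ((P.L : ℝ) ^ P.d)⁻¹ * (P.L : ℝ) * P.d))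
          * Real.sqrt (∑ b : PBond P j, ‖Z b‖ ^ 2) := by
  have hθ0 : 0 ≤ θ := (GaugeGroup.dist1_nonneg _).trans (hθ ⟨Classical.arbitrary _, Classical.arbitrary _⟩ (Classical.arbitrary _))
  have hL0 : (0 : ℝ) ≤ (P.L : ℝ) := Nat.cast_nonneg _
  have hLd : (0 : ℝ) < (P.L : ℝ) ^ P.d := by have := P.L_pos; positivity
  -- the three pointwise pieces
  set a : PBond P (j + 1) → Fin P.d → ℝ := fun c ν => ((P.L : ℝ) ^ P.d)⁻¹ * ∑ r : Fin P.d → Fin P.L, ∑ s ∈ range P.L, ∑ t ∈ range P.L,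
      ‖((V ⟨(fun z : Site P j => z.shift c.dir)^[t] ((fun z : Site P j => z.shift ν)^[s] (Site.blockSite c.src r)), ν⟩ : Matrix.specialUnitaryGroup n ℂ) : Matrix n n ℂ)
          * Z ⟨((fun z : Site P j => z.shift c.dir)^[t] ((fun z : Site P j => z.shift ν)^[s] (Site.blockSite c.src r))).shift ν, c.dir⟩
          * star ((V ⟨(fun z : Site P j => z.shift c.dir)^[t] ((fun z : Site P j => z.shift ν)^[s] (Site.blockSite c.src r)), ν⟩ :
              Matrix.specialUnitaryGroup n ℂ) : Matrix n n ℂ)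
        - Z ⟨(fun z : Site P j => z.shift c.dir)^[t] ((fun z : Site P j => z.shift ν)^[s] (Site.blockSite c.src r)), c.dir⟩‖ with ha
  set b : PBond P (j + 1) → Fin P.d → ℝ := fun c ν => 2 * (P.L : ℝ) ^ 2 * δ * (((P.L : ℝ) ^ P.d)⁻¹ * ∑ r : Fin P.d → Fin P.L, ∑ s ∈ range P.L, ∑ t ∈ range P.L,
      ‖Z ⟨((fun z : Site P j => z.shift c.dir)^[t] ((fun z : Site P j => z.shift ν)^[s] (Site.blockSite c.src r))).shift ν, c.dir⟩‖) with hb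
  set e : PBond P (j + 1) → Fin P.d → ℝ := fun c ν => (2 * ((P.d : ℝ) + 2) ^ 2 * (P.L : ℝ) ^ 2 * δ + 4 * θ) * (((P.L : ℝ) ^ P.d)⁻¹ *
      ∑ r : Fin P.d → Fin P.L, ∑ t ∈ range P.L, ‖Z ⟨(fun z : Site P j => z.shift c.dir)^[t] (Site.blockSite (c.src.shift ν) r), c.dir⟩‖) with he
  have ha0 : ∀ c ν, 0 ≤ a c ν := fun c ν => by
    rw [ha]; exact mul_nonneg (inv_nonneg.mpr hLd.le) (Finset.sum_nonneg fun _ _ => Finset.sum_nonneg fun _ _ => Finset.sum_nonneg fun _ _ => norm_nonneg _)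
  have hb0 : ∀ c ν, 0 ≤ b c ν := fun c ν => by
    rw [hb]; exact mul_nonneg (by positivity) (mul_nonneg (inv_nonneg.mpr hLd.le)
      (Finset.sum_nonneg fun _ _ => Finset.sum_nonneg fun _ _ => Finset.sum_nonneg fun _ _ => norm_nonneg _))
  have he0 : ∀ c ν, 0 ≤ e c ν := fun c ν => by
    rw [he]; exact mul_nonneg (by positivity) (mul_nonneg (inv_nonneg.mpr hLd.le) (Finset.sum_nonneg fun _ _ => Finset.sum_nonneg fun _ _ => norm_nonneg _))
  -- pointwise
  have hpt : ∀ (c : PBond P (j + 1)) (ν : Fin P.d),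
      ‖((avgFun (expMeanLogSU (n := n)) V ⟨c.src, ν⟩ : Matrix.specialUnitaryGroup n ℂ) : Matrix n n ℂ)
            * (((Fintype.card (Idx P) : ℂ))⁻¹ • ∑ i : Idx P,
                ((holAt V (walk (emb (c.src.shift ν)) (stairWord i.2.1 (off i.1))) : Matrix.specialUnitaryGroup n ℂ) : Matrix n n ℂ) *
                  covWalkSum V Z (walk (walkEnd (emb (c.src.shift ν)) (stairWord i.2.1 (off i.1))) (List.replicate P.L (c.dir, true))) *
                star ((holAt V (walk (emb (c.src.shift ν)) (stairWord i.2.1 (off i.1))) : Matrix.specialUnitaryGroup n ℂ) : Matrix n n ℂ))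
            * star ((avgFun (expMeanLogSU (n := n)) V ⟨c.src, ν⟩ : Matrix.specialUnitaryGroup n ℂ) : Matrix n n ℂ)
          - ((Fintype.card (Idx P) : ℂ))⁻¹ • ∑ i : Idx P,
              ((holAt V (walk (emb c.src) (stairWord i.2.1 (off i.1))) : Matrix.specialUnitaryGroup n ℂ) : Matrix n n ℂ) *
                covWalkSum V Z (walk (walkEnd (emb c.src) (stairWord i.2.1 (off i.1))) (List.replicate P.L (c.dir, true))) *
              star ((holAt V (walk (emb c.src) (stairWord i.2.1 (off i.1))) : Matrix.specialUnitaryGroup n ℂ) : Matrix n n ℂ)‖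
        ≤ a c ν + b c ν + e c ν := by
    intro c ν
    have h := norm_covGrad_line_le V hδ hV Z c.src c.dir ν (hθ ⟨c.src, ν⟩) hθN hθ6
    rw [ha, hb, he]
    exact h
  -- square-sum and Minkowski
  have hsq : ∀ (c : PBond P (j + 1)) (ν : Fin P.d),
      ‖((avgFun (expMeanLogSU (n := n)) V ⟨c.src, ν⟩ : Matrix.specialUnitaryGroup n ℂ) : Matrix n n ℂ)
            * (((Fintype.card (Idx P) : ℂ))⁻¹ • ∑ i : Idx P,
                ((holAt V (walk (emb (c.src.shift ν)) (stairWord i.2.1 (off i.1))) : Matrix.specialUnitaryGroup n ℂ) : Matrix n n ℂ) *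
                  covWalkSum V Z (walk (walkEnd (emb (c.src.shift ν)) (stairWord i.2.1 (off i.1))) (List.replicate P.L (c.dir, true))) *
                star ((holAt V (walk (emb (c.src.shift ν)) (stairWord i.2.1 (off i.1))) : Matrix.specialUnitaryGroup n ℂ) : Matrix n n ℂ))
            * star ((avgFun (expMeanLogSU (n := n)) V ⟨c.src, ν⟩ : Matrix.specialUnitaryGroup n ℂ) : Matrix n n ℂ)
          - ((Fintype.card (Idx P) : ℂ))⁻¹ • ∑ i : Idx P,
              ((holAt V (walk (emb c.src) (stairWord i.2.1 (off i.1))) : Matrix.specialUnitaryGroup n ℂ) : Matrix n n ℂ) *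
                covWalkSum V Z (walk (walkEnd (emb c.src) (stairWord i.2.1 (off i.1))) (List.replicate P.L (c.dir, true))) *
              star ((holAt V (walk (emb c.src) (stairWord i.2.1 (off i.1))) : Matrix.specialUnitaryGroup n ℂ) : Matrix n n ℂ)‖ ^ 2
        ≤ (a c ν + b c ν + e c ν) ^ 2 := fun c ν => pow_le_pow_left₀ (norm_nonneg _) (hpt c ν) 2
  refine (Real.sqrt_le_sqrt (Finset.sum_le_sum fun c _ => Finset.sum_le_sum fun ν _ => hsq c ν)).trans ?_
  refine (sqrt_sum_sum_sq_add3_le a b e ha0 hb0 he0).trans ?_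
  -- (1) the main piece: constant exactly `L⁴L^{−d}`
  have hA : ∑ c : PBond P (j + 1), ∑ ν : Fin P.d, a c ν ^ 2
      ≤ (P.L : ℝ) ^ 2 * (P.L : ℝ) ^ 2 * ((P.L : ℝ) ^ P.d)⁻¹ * ∑ b : PBond P j, ∑ ν : Fin P.d,
          ‖((V ⟨b.src, ν⟩ : Matrix.specialUnitaryGroup n ℂ) : Matrix n n ℂ) * Z ⟨b.src.shift ν, b.dir⟩
              * star ((V ⟨b.src, ν⟩ : Matrix.specialUnitaryGroup n ℂ) : Matrix n n ℂ) - Z b‖ ^ 2 := by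
    have step1 : ∑ c : PBond P (j + 1), ∑ ν : Fin P.d, a c ν ^ 2 = ∑ μ : Fin P.d, ∑ ν : Fin P.d, ∑ y : Site P (j + 1), a ⟨y, μ⟩ ν ^ 2 := by
      rw [sum_pbond (fun c : PBond P (j + 1) => ∑ ν : Fin P.d, a c ν ^ 2), Finset.sum_comm]
      exact Finset.sum_congr rfl fun μ _ => Finset.sum_comm
    have step2 : ∑ b : PBond P j, ∑ ν : Fin P.d,
          ‖((V ⟨b.src, ν⟩ : Matrix.specialUnitaryGroup n ℂ) : Matrix n n ℂ) * Z ⟨b.src.shift ν, b.dir⟩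
              * star ((V ⟨b.src, ν⟩ : Matrix.specialUnitaryGroup n ℂ) : Matrix n n ℂ) - Z b‖ ^ 2
        = ∑ μ : Fin P.d, ∑ ν : Fin P.d, ∑ x : Site P j,
          ‖((V ⟨x, ν⟩ : Matrix.specialUnitaryGroup n ℂ) : Matrix n n ℂ) * Z ⟨x.shift ν, μ⟩ * star ((V ⟨x, ν⟩ : Matrix.specialUnitaryGroup n ℂ) : Matrix n n ℂ)
            - Z ⟨x, μ⟩‖ ^ 2 := by
      simp only [sum_pbond (fun b : PBond P j => ∑ ν : Fin P.d,
          ‖((V ⟨b.src, ν⟩ : Matrix.specialUnitaryGroup n ℂ) : Matrix n n ℂ) * Z ⟨b.src.shift ν, b.dir⟩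
              * star ((V ⟨b.src, ν⟩ : Matrix.specialUnitaryGroup n ℂ) : Matrix n n ℂ) - Z b‖ ^ 2)]
      rw [Finset.sum_comm]
      exact Finset.sum_congr rfl fun μ _ => Finset.sum_comm
    rw [step1, step2, Finset.mul_sum]
    refine Finset.sum_le_sum fun μ _ => ?_
    rw [Finset.mul_sum]
    refine Finset.sum_le_sum fun ν _ => ?_
    have h := sum_sq_blockDoubleLine_le hj (fun x => ‖((V ⟨x, ν⟩ : Matrix.specialUnitaryGroup n ℂ) : Matrix n n ℂ) * Z ⟨x.shift ν, μ⟩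
      * star ((V ⟨x, ν⟩ : Matrix.specialUnitaryGroup n ℂ) : Matrix n n ℂ) - Z ⟨x, μ⟩‖) μ ν
    refine le_trans (le_of_eq (Finset.sum_congr rfl fun y _ => ?_)) h
    simp only [ha]
  -- (2) the ladder piece
  have hB : ∑ c : PBond P (j + 1), ∑ ν : Fin P.d, b c ν ^ 2
      ≤ (2 * (P.L : ℝ) ^ 2 * δ) ^ 2 * ((P.L : ℝ) ^ 2 * (P.L : ℝ) ^ 2 * ((P.L : ℝ) ^ P.d)⁻¹ * P.d) * ∑ b : PBond P j, ‖Z b‖ ^ 2 := by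
    have step1 : ∑ c : PBond P (j + 1), ∑ ν : Fin P.d, b c ν ^ 2 = ∑ μ : Fin P.d, ∑ ν : Fin P.d, ∑ y : Site P (j + 1), b ⟨y, μ⟩ ν ^ 2 := by
      rw [sum_pbond (fun c : PBond P (j + 1) => ∑ ν : Fin P.d, b c ν ^ 2), Finset.sum_comm]
      exact Finset.sum_congr rfl fun μ _ => Finset.sum_comm
    have step2 : ∑ b : PBond P j, ‖Z b‖ ^ 2 = ∑ μ : Fin P.d, ∑ x : Site P j, ‖Z ⟨x, μ⟩‖ ^ 2 := by
      rw [sum_pbond (fun b : PBond P j => ‖Z b‖ ^ 2), Finset.sum_comm]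
    have hin : ∀ μ ν : Fin P.d, ∑ y : Site P (j + 1), b ⟨y, μ⟩ ν ^ 2
        ≤ (2 * (P.L : ℝ) ^ 2 * δ) ^ 2 * ((P.L : ℝ) ^ 2 * (P.L : ℝ) ^ 2 * ((P.L : ℝ) ^ P.d)⁻¹) * ∑ x : Site P j, ‖Z ⟨x, μ⟩‖ ^ 2 := by
      intro μ ν
      have h := sum_sq_blockDoubleLine_le hj (fun x => ‖Z ⟨x.shift ν, μ⟩‖) μ ν
      have hs : ∑ x : Site P j, ‖Z ⟨x.shift ν, μ⟩‖ ^ 2 = ∑ x : Site P j, ‖Z ⟨x, μ⟩‖ ^ 2 :=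
        Equiv.sum_comp (shiftEquiv (P := P) (i := j) ν) (fun x => ‖Z ⟨x, μ⟩‖ ^ 2)
      rw [hs] at h
      have e1 : ∑ y : Site P (j + 1), b ⟨y, μ⟩ ν ^ 2 = (2 * (P.L : ℝ) ^ 2 * δ) ^ 2 * ∑ y : Site P (j + 1),
          ((((P.L : ℝ)) ^ P.d)⁻¹ * ∑ r : Fin P.d → Fin P.L, ∑ s ∈ range P.L, ∑ t ∈ range P.L,
            ‖Z ⟨((fun z : Site P j => z.shift μ)^[t] ((fun z : Site P j => z.shift ν)^[s] (Site.blockSite y r))).shift ν, μ⟩‖) ^ 2 := by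
        rw [Finset.mul_sum]
        refine Finset.sum_congr rfl fun y _ => ?_
        simp only [hb]
        ring
      rw [e1]
      have := mul_le_mul_of_nonneg_left h (sq_nonneg (2 * (P.L : ℝ) ^ 2 * δ))
      linarith
    rw [step1, step2, Finset.mul_sum]
    refine Finset.sum_le_sum fun μ _ => ?_
    calc ∑ ν : Fin P.d, ∑ y : Site P (j + 1), b ⟨y, μ⟩ ν ^ 2
        ≤ ∑ _ν : Fin P.d, (2 * (P.L : ℝ) ^ 2 * δ) ^ 2 * ((P.L : ℝ) ^ 2 * (P.L : ℝ) ^ 2 * ((P.L : ℝ) ^ P.d)⁻¹) * ∑ x : Site P j, ‖Z ⟨x, μ⟩‖ ^ 2 :=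
          Finset.sum_le_sum fun ν _ => hin μ ν
      _ = _ := by rw [Finset.sum_const, Finset.card_univ, Fintype.card_fin, nsmul_eq_mul]; ring
  -- (3) the frame∕corr piece
  have hE : ∑ c : PBond P (j + 1), ∑ ν : Fin P.d, e c ν ^ 2
      ≤ (2 * ((P.d : ℝ) + 2) ^ 2 * (P.L : ℝ) ^ 2 * δ + 4 * θ) ^ 2 * ((P.L : ℝ) * ((P.L : ℝ) ^ P.d)⁻¹ * (P.L : ℝ) * P.d) * ∑ b : PBond P j, ‖Z b‖ ^ 2 := by
    have step1 : ∑ c : PBond P (j + 1), ∑ ν : Fin P.d, e c ν ^ 2 = ∑ μ : Fin P.d, ∑ ν : Fin P.d, ∑ y : Site P (j + 1), e ⟨y, μ⟩ ν ^ 2 := by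
      rw [sum_pbond (fun c : PBond P (j + 1) => ∑ ν : Fin P.d, e c ν ^ 2), Finset.sum_comm]
      exact Finset.sum_congr rfl fun μ _ => Finset.sum_comm
    have step2 : ∑ b : PBond P j, ‖Z b‖ ^ 2 = ∑ μ : Fin P.d, ∑ x : Site P j, ‖Z ⟨x, μ⟩‖ ^ 2 := by
      rw [sum_pbond (fun b : PBond P j => ‖Z b‖ ^ 2), Finset.sum_comm]
    have hin : ∀ μ ν : Fin P.d, ∑ y : Site P (j + 1), e ⟨y, μ⟩ ν ^ 2
        ≤ (2 * ((P.d : ℝ) + 2) ^ 2 * (P.L : ℝ) ^ 2 * δ + 4 * θ) ^ 2 * ((P.L : ℝ) * ((P.L : ℝ) ^ P.d)⁻¹ * (P.L : ℝ)) * ∑ x : Site P j, ‖Z ⟨x, μ⟩‖ ^ 2 := by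
      intro μ ν
      have h := sum_sq_blockLine_le hj (fun x => ‖Z ⟨x, μ⟩‖) μ ν
      have e1 : ∑ y : Site P (j + 1), e ⟨y, μ⟩ ν ^ 2 = (2 * ((P.d : ℝ) + 2) ^ 2 * (P.L : ℝ) ^ 2 * δ + 4 * θ) ^ 2 * ∑ y : Site P (j + 1),
          ((((P.L : ℝ)) ^ P.d)⁻¹ * ∑ r : Fin P.d → Fin P.L, ∑ t ∈ range P.L, ‖Z ⟨(fun z : Site P j => z.shift μ)^[t] (Site.blockSite (y.shift ν) r), μ⟩‖) ^ 2 := by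
        rw [Finset.mul_sum]
        refine Finset.sum_congr rfl fun y _ => ?_
        simp only [he]
        ring
      rw [e1]
      have := mul_le_mul_of_nonneg_left h (sq_nonneg (2 * ((P.d : ℝ) + 2) ^ 2 * (P.L : ℝ) ^ 2 * δ + 4 * θ))
      linarith
    rw [step1, step2, Finset.mul_sum]
    refine Finset.sum_le_sum fun μ _ => ?_
    calc ∑ ν : Fin P.d, ∑ y : Site P (j + 1), e ⟨y, μ⟩ ν ^ 2
        ≤ ∑ _ν : Fin P.d, (2 * ((P.d : ℝ) + 2) ^ 2 * (P.L : ℝ) ^ 2 * δ + 4 * θ) ^ 2 * ((P.L : ℝ) * ((P.L : ℝ) ^ P.d)⁻¹ * (P.L : ℝ)) * ∑ x : Site P j, ‖Z ⟨x, μ⟩‖ ^ 2 :=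
          Finset.sum_le_sum fun ν _ => hin μ ν
      _ = _ := by rw [Finset.sum_const, Finset.card_univ, Fintype.card_fin, nsmul_eq_mul]; ring
  -- take square roots
  have hc3 : 0 ≤ 2 * ((P.d : ℝ) + 2) ^ 2 * (P.L : ℝ) ^ 2 * δ + 4 * θ := by positivity
  have hc2 : 0 ≤ 2 * (P.L : ℝ) ^ 2 * δ := by positivity
  have h1 := Real.sqrt_le_sqrt hA
  have h2 := Real.sqrt_le_sqrt hB
  have h3 := Real.sqrt_le_sqrt hE
  rw [Real.sqrt_mul (by positivity)] at h1
  rw [Real.sqrt_mul (by positivity), Real.sqrt_mul (by positivity), Real.sqrt_sq hc2] at h2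
  rw [Real.sqrt_mul (by positivity), Real.sqrt_mul (by positivity), Real.sqrt_sq hc3] at h3
  have hZ0 : 0 ≤ Real.sqrt (∑ b : PBond P j, ‖Z b‖ ^ 2) := Real.sqrt_nonneg _
  nlinarith [h1, h2, h3, hZ0, Real.sqrt_nonneg ((P.L : ℝ) ^ 2 * (P.L : ℝ) ^ 2 * ((P.L : ℝ) ^ P.d)⁻¹ * P.d),
    Real.sqrt_nonneg ((P.L : ℝ) * ((P.L : ℝ) ^ P.d)⁻¹ * (P.L : ℝ) * P.d)]

end Summit.QuantumFields.YangMills.Theorems.Prop7CovLineGradL2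

end
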